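import Literature.Analysis.Calculus.ConePoincareHomotopy
import Mathlib.MeasureTheory.Integral.DominatedConvergence
import Mathlib.Analysis.Convex.Star
import HarnessLib

/-!
# The cone homotopy operator: continuity, equivariance under linear maps, and `h ∘ h = 0`

Complements to `Literature/Analysis/Calculus/ConePoincareHomotopy.lean` (the cone operator
`conePrimitive x₀ ω`, `(h ω)(y) = ∫₀¹ tⁿ ω(x₀ + t(y - x₀))(y - x₀, …) dt`):

* `continuousAt_conePrimitive` — `h ω` is continuous at every point carrying a local bound of `ω`
  over the cones on a ball (dominated convergence);
* `conePrimitive_comp_clm` — **equivariance under linear maps**: if `ω (A y)(A v₀, …) = T (ω' y v)`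
  on a star-shaped `X` for continuous linear `A`, `T`, then
  `(h_{A x₀} ω)(A y)(A v₁, …) = T ((h_{x₀} ω') y v)` — the base point moves with `A`
  (`conePt_map`); this is what makes the cone operator compatible with the action of a group acting
  linearly on the base and on the values (as `conePeriod_comp_clm` for cone periods);
* `conePrimitive_conePrimitive_apply` — **`h_{x₀} (h_{x₀} ω) = 0`**: two insertions of the radial
  vector.

These are the formal properties of `h` used by the van Est / Čech–de Rham staircase (the descent
`ω ↦ h ω ↦ δ h ω ↦ h δ h ω ↦ …` towards Dupont's cone cocycle).  Theorems only, no `sorry`.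

[cite: Spivak1965, Thm. 4-11] [cite: Dupont1976, §1–2]

## References

* M. Spivak, *Calculus on Manifolds* (1965), Thm. 4-11. [Spivak1965]
* J. L. Dupont, Topology 15 (1976), §1–2. [Dupont1976]
-/

noncomputable section

open Set MeasureTheory intervalIntegral Filter Topology
open scoped Interval

namespace Literature.Analysis.Calculus

variable {E F : Type*} [NormedAddCommGroup E] [NormedSpace ℝ E] [NormedAddCommGroup F] [NormedSpace ℝ F]
  {E' F' : Type*} [NormedAddCommGroup E'] [NormedSpace ℝ E'] [NormedAddCommGroup F'] [NormedSpace ℝ F']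
  {n : ℕ}

/-! ### Linear maps move the base point -/

/-- `A (x₀ + t (y - x₀)) = A x₀ + t (A y - A x₀)`. [folklore] -/
theorem conePt_map (A : E →L[ℝ] E') (x₀ y : E) (t : ℝ) : conePt (A x₀) (A y) t = A (conePt x₀ y t) := by
  simp only [conePt, map_add, map_smul, map_sub]

/-! ### Continuity of the cone operator -/

/-- **The cone operator is continuous** at every point `y` of a set `X`, star-shaped with respect to
`x₀`, on which `ω` is continuous, granted a uniform bound of `ω` over the cones on a ball at `y`
inside `X` (dominated convergence). [folklore] -/
theorem continuousAt_conePrimitive {ω : E → E [⋀^Fin (n + 1)]→L[ℝ] F} {X : Set E} {x₀ : E}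
    (hXo : IsOpen X) (hX : StarConvex ℝ x₀ X) (hc : ContinuousOn ω X) {y : E} {r C : ℝ} (hr : 0 < r)
    (hball : Metric.ball y r ⊆ X) (hC : ∀ y' ∈ Metric.ball y r, ∀ t ∈ Icc (0 : ℝ) 1, ‖ω (conePt x₀ y' t)‖ ≤ C) :
    ContinuousAt (conePrimitive x₀ ω) y := by
  have hyX : ∀ y' ∈ Metric.ball y r, y' ∈ X := fun y' hy' => hball hy'
  have hI : Ι (0 : ℝ) 1 = Ioc 0 1 := uIoc_of_le zero_le_one
  have hFc : ∀ y' ∈ Metric.ball y r,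
      ContinuousOn (fun t : ℝ => (t ^ n) • (ω (conePt x₀ y' t)).curryLeft (y' - x₀)) (Icc 0 1) := by
    intro y' hy'
    refine (continuousOn_pow n).smul ?_
    have h1 : ContinuousOn (fun t => curryLeftCLM F n (ω (conePt x₀ y' t)) (y' - x₀)) (Icc 0 1) :=
      ((curryLeftCLM F n).continuous.comp_continuousOn (continuousOn_comp_conePt hc hX (hyX y' hy'))).clm_apply
        continuousOn_const
    simpa using h1
  refine intervalIntegral.continuousAt_of_dominated_interval (μ := volume)
    (F := fun (y' : E) (t : ℝ) => (t ^ n) • (ω (conePt x₀ y' t)).curryLeft (y' - x₀))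
    (bound := fun _ => C * (‖y - x₀‖ + r)) ?_ ?_ intervalIntegrable_const ?_
  · filter_upwards [Metric.ball_mem_nhds y hr] with y' hy'
    rw [hI]
    exact ((hFc y' hy').mono Ioc_subset_Icc_self).aestronglyMeasurable measurableSet_Ioc
  · filter_upwards [Metric.ball_mem_nhds y hr] with y' hy'
    refine Filter.Eventually.of_forall fun t ht => ?_
    rw [hI] at ht
    have ht' : t ∈ Icc (0 : ℝ) 1 := ⟨ht.1.le, ht.2⟩
    have hωC := hC y' hy' t ht'
    have h0C : 0 ≤ C := (norm_nonneg _).trans hωC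
    have ht1 : |t| ^ n ≤ 1 := pow_le_one₀ (abs_nonneg t) (abs_le.2 ⟨by linarith [ht.1], ht.2⟩)
    have hdist : ‖y' - x₀‖ ≤ ‖y - x₀‖ + r := by
      have h1 : ‖y' - x₀‖ ≤ ‖y' - y‖ + ‖y - x₀‖ := norm_sub_le_norm_sub_add_norm_sub y' y x₀
      have h2 : ‖y' - y‖ < r := by rwa [← dist_eq_norm]
      linarith
    calc ‖(t ^ n) • (ω (conePt x₀ y' t)).curryLeft (y' - x₀)‖
        = |t| ^ n * ‖(ω (conePt x₀ y' t)).curryLeft (y' - x₀)‖ := by rw [norm_smul, norm_pow, Real.norm_eq_abs]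
      _ ≤ 1 * (‖ω (conePt x₀ y' t)‖ * ‖y' - x₀‖) :=
          mul_le_mul ht1 (norm_curryLeft_apply_le _ _) (norm_nonneg _) zero_le_one
      _ ≤ C * (‖y - x₀‖ + r) := by rw [one_mul]; gcongr
  · refine Filter.Eventually.of_forall fun t ht => ?_
    rw [hI] at ht
    have ht' : t ∈ Icc (0 : ℝ) 1 := ⟨ht.1.le, ht.2⟩
    -- `y' ↦ tⁿ (ω (x_t y')).curryLeft (y' - x₀)` is continuous at `y`
    have hy : y ∈ X := hball (Metric.mem_ball_self hr)
    have hωy : ContinuousAt (fun y' : E => ω (conePt x₀ y' t)) y := by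
      have h1 : ContinuousAt ω (conePt x₀ y t) := hc.continuousAt (hXo.mem_nhds (conePt_mem hX hy ht'))
      have h2 : Continuous fun y' : E => conePt x₀ y' t :=
        continuous_const.add (continuous_const.smul (continuous_id.sub continuous_const))
      exact ContinuousAt.comp (g := ω) h1 h2.continuousAt
    have h3 : ContinuousAt (fun y' : E => curryLeftCLM F n (ω (conePt x₀ y' t)) (y' - x₀)) y :=
      ((curryLeftCLM F n).continuous.continuousAt.comp hωy).clm_apply (continuous_id.sub continuous_const).continuousAt
    have h4 : ContinuousAt (fun y' : E => (t ^ n) • curryLeftCLM F n (ω (conePt x₀ y' t)) (y' - x₀)) y :=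
      h3.const_smul (t ^ n)
    simpa using h4

/-! ### Equivariance under linear maps -/

/-- **Equivariance of the cone operator under linear maps.**  If `A : E → E'` and `T : F → F'` are
continuous linear and `ω (A y) (A v₀, …, A vₙ) = T (ω' y v)` for `y` in a set `X` star-shaped with
respect to `x₀`, with `ω'` continuous on `X` and `ω` continuous on `A '' X`, then for `y ∈ X`:
`(h_{A x₀} ω)(A y)(A v₁, …, A vₙ) = T ((h_{x₀} ω') y v)` — the base point moves with `A`.
[cite: Dupont1976, §1–2] -/
theorem conePrimitive_comp_clm [CompleteSpace F] [CompleteSpace F'] {X : Set E} {x₀ : E} (hX : StarConvex ℝ x₀ X)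
    (A : E →L[ℝ] E') (T : F →L[ℝ] F') {ω : E' → E' [⋀^Fin (n + 1)]→L[ℝ] F'}
    {ω' : E → E [⋀^Fin (n + 1)]→L[ℝ] F} (hω : ContinuousOn ω (⇑A '' X)) (hω' : ContinuousOn ω' X)
    (h : ∀ y ∈ X, ∀ v : Fin (n + 1) → E, ω (A y) (fun j => A (v j)) = T (ω' y v))
    {y : E} (hy : y ∈ X) (v : Fin n → E) :
    conePrimitive (A x₀) ω (A y) (fun j => A (v j)) = T (conePrimitive x₀ ω' y v) := by
  have hAX : StarConvex ℝ (A x₀) (⇑A '' X) := hX.linear_image A.toLinearMap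
  have hAy : A y ∈ ⇑A '' X := mem_image_of_mem _ hy
  rw [conePrimitive_apply hω hAX hAy, conePrimitive_apply hω' hX hy,
    ← T.intervalIntegral_comp_comm]
  · refine integral_congr fun t ht => ?_
    rw [uIcc_of_le zero_le_one] at ht
    simp only [conePt_map, map_smul]
    have e : Matrix.vecCons (A y - A x₀) (fun j => A (v j)) = fun j => A (Matrix.vecCons (y - x₀) v j) := by
      funext j
      refine Fin.cases ?_ (fun k => ?_) j
      · simp [map_sub]
      · simp
    rw [e, h _ (conePt_mem hX hy ht)]
  · refine ContinuousOn.intervalIntegrable ?_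
    rw [uIcc_of_le zero_le_one]
    exact (continuousOn_pow n).smul
      ((ContinuousAlternatingMap.apply ℝ E F (Matrix.vecCons (y - x₀) v)).continuous.comp_continuousOn
        (continuousOn_comp_conePt hω' hX hy))

/-! ### Two radial insertions vanish -/

/-- **`h_{x₀} (h_{x₀} ω) = 0`**: the cone operator applied twice from the same base point vanishes
(the radial vector `y - x₀` is inserted twice into an alternating map), at every `y ∈ X` with `ω`
and `h ω` continuous on the star-shaped `X`. [cite: Spivak1965, Thm. 4-11] -/
theorem conePrimitive_conePrimitive_apply [CompleteSpace F] {X : Set E} {x₀ : E} (hX : StarConvex ℝ x₀ X)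
    {ω : E → E [⋀^Fin (n + 2)]→L[ℝ] F} (hc : ContinuousOn ω X) (hhc : ContinuousOn (conePrimitive x₀ ω) X)
    {y : E} (hy : y ∈ X) (v : Fin n → E) :
    conePrimitive x₀ (conePrimitive x₀ ω) y v = 0 := by
  rw [conePrimitive_apply hhc hX hy]
  refine (integral_congr (g := fun _ => (0 : F)) fun s hs => ?_).trans (by simp)
  rw [uIcc_of_le zero_le_one] at hs
  have hxs : conePt x₀ y s ∈ X := conePt_mem hX hy hs
  rw [conePrimitive_apply hc hX hxs]
  have e0 : ∀ t : ℝ, ω (conePt x₀ (conePt x₀ y s) t) (Matrix.vecCons (conePt x₀ y s - x₀) (Matrix.vecCons (y - x₀) v)) = 0 := by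
    intro t
    have hrad : conePt x₀ y s - x₀ = s • (y - x₀) := by simp only [conePt, add_sub_cancel_left]
    rw [hrad]
    have key := (ω (conePt x₀ (conePt x₀ y s) t)).map_eq_zero_of_eq
      (Matrix.vecCons (y - x₀) (Matrix.vecCons (y - x₀) v)) (i := 0) (j := 1) (by simp) Fin.zero_ne_one
    have hlin : ω (conePt x₀ (conePt x₀ y s) t) (Matrix.vecCons (s • (y - x₀)) (Matrix.vecCons (y - x₀) v)) =
        s • ω (conePt x₀ (conePt x₀ y s) t) (Matrix.vecCons (y - x₀) (Matrix.vecCons (y - x₀) v)) := by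
      rw [← ContinuousAlternatingMap.curryLeft_apply_apply, map_smul, ContinuousAlternatingMap.smul_apply,
        ContinuousAlternatingMap.curryLeft_apply_apply]
    rw [hlin, key, smul_zero]
  simp only [e0, smul_zero, intervalIntegral.integral_zero]

end Literature.Analysis.Calculus

end
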